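import Literature.Geometry.Lorentzian.PseudoRiemannianMetric
import HarnessLib

/-!
# Conic combinations of Riemannian metrics and the linear path `γ_t = (1 - t) γ₀ + t γ₁`

Topic `Literature/Geometry/Riemannian`; general pseudo-Riemannian API next to
`Literature.Geometry.Lorentzian.PseudoRiemannianMetric` (dot-notation extensions of that
structure, declared with absolute names as `CONVENTIONS.md` §2 prescribes). Written for the
PSC collar of Shi–Wang–Wei (J. reine angew. Math. 784 (2022), Lemma 2.1, first sentence of the
proof: "Set `γ_t = (1-t)γ₀ + tγ₁`. Then `{γ_t}_{t∈[0,1]}` is a smooth path of metrics on `Σ`"),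
the step (2) object of the named fact `ShiWangWei2022_boundaryMetric_extends_psc`
(`BoundaryMetricExtension.lean`; the cylinder metric `u² dt² + γ_t` built on this path is in
`BoundaryMetricExtensionCollar.lean`), but general: any real vector bundle, any regularity `C^n`.

* `PseudoRiemannianMetric.conicComb g₀ g₁ h₀ h₁ a b …` — `a g₀ + b g₁` for Riemannian `C^n`
  metrics `g₀, g₁` and constants `a, b ≥ 0`, `a + b > 0`: again a `C^n` metric
  (nondegenerate because positive definite), Riemannian (`isRiemannian_conicComb`), with
  `1·g₀ + 0·g₁ = g₀`, `0·g₀ + 1·g₁ = g₁`.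
* `PseudoRiemannianMetric.linePath g₀ g₁ h₀ h₁ t ht` — `γ_t = (1 - t) γ₀ + t γ₁`, `t ∈ [0, 1]`:
  Riemannian, `γ_0 = γ₀`, `γ_1 = γ₁`, affine in `t` (`γ_t - γ_s = (t - s)(γ₁ - γ₀)`, so the
  velocity of the path is the constant form `γ₁ - γ₀` — the source of `Ā_t = ½ (γ₁ - γ₀)` and of
  `H̄_t > 0` when `γ₁ > γ₀` in the printed proof), and monotone: `γ_s(v,v) ≤ γ_t(v,v)` for
  `s ≤ t` when `γ₀ ≤ γ₁`.

Everything is proved; no named facts. The Riemannian hypotheses are arguments of the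
definitions (a conic combination of indefinite metrics can degenerate).

## References

* Y. Shi, W. Wang, G. Wei, *Total mean curvature of the boundary and nonnegative scalar curvature
  fill-ins*, J. reine angew. Math. 784 (2022) 215–250 = arXiv:2007.06756, §2, proof of
  Lemma 2.1. [ShiWangWei2022]
* B. O'Neill, *Semi-Riemannian geometry with applications to relativity* (1983), Ch. 3, Def. 3.1.
  [ONeill1983]
-/

noncomputable section

open Bundle Set Function
open scoped Manifold ContDiff Topology

namespace Literature.Geometry.Riemannian

open Lorentzian Lorentzian.PseudoRiemannianMetric

/-! ### Conic combinations of Riemannian metrics and the path `γ_t = (1 - t) γ₀ + t γ₁` -/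

section ConicComb

variable {EB : Type*} [NormedAddCommGroup EB] [NormedSpace ℝ EB] {HB : Type*}
  [TopologicalSpace HB] {IB : ModelWithCorners ℝ EB HB} {n : ℕ∞ω} {B : Type*}
  [TopologicalSpace B] [ChartedSpace HB B] {F : Type*} [NormedAddCommGroup F] [NormedSpace ℝ F]
  {V : B → Type*} [TopologicalSpace (TotalSpace F V)] [∀ b, TopologicalSpace (V b)]
  [∀ b, AddCommGroup (V b)] [∀ b, Module ℝ (V b)] [FiberBundle F V] [VectorBundle ℝ F V]

/-- **Conic combination of Riemannian metrics.** For Riemannian `C^n` metrics `g₀`, `g₁` on a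
vector bundle and constants `a, b ≥ 0` with `a + b > 0`, `a g₀ + b g₁` is again a `C^n`
pseudo-Riemannian metric (symmetric; nondegenerate because positive definite; `C^n` by
`ContMDiff.const_smul_section` / `add_section`). Dot-notation extension of
`Literature.Geometry.Lorentzian.PseudoRiemannianMetric`, declared with its absolute name. The case
`a = 1 - t`, `b = t` is the path of metrics of Shi–Wang–Wei 2022, proof of Lemma 2.1; cf.
O'Neill 1983, Ch. 3, Def. 3.1. [folklore] -/
def _root_.Literature.Geometry.Lorentzian.PseudoRiemannianMetric.conicComb
    (g₀ g₁ : PseudoRiemannianMetric IB n F V) (h₀ : g₀.IsRiemannian) (h₁ : g₁.IsRiemannian)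
    (a b : ℝ) (ha : 0 ≤ a) (hb : 0 ≤ b) (hab : 0 < a + b) : PseudoRiemannianMetric IB n F V where
  val x := a • g₀.val x + b • g₁.val x
  symm x v w := by
    simp only [add_apply, FunLike.coe_smul, Pi.smul_apply, smul_eq_mul]
    rw [g₀.symm x v w, g₁.symm x v w]
  nondegenerate x v hv := by
    by_contra hne
    have h0 := h₀ x v hne
    have h1 := h₁ x v hne
    have key : 0 < a * g₀.val x v v + b * g₁.val x v v := by
      rcases ha.eq_or_lt with hzero | ha'
      · have hb' : 0 < b := by rw [← hzero, zero_add] at hab; exact hab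
        rw [← hzero, zero_mul, zero_add]
        exact mul_pos hb' h1
      · exact add_pos_of_pos_of_nonneg (mul_pos ha' h0) (mul_nonneg hb h1.le)
    have h' : a * g₀.val x v v + b * g₁.val x v v = 0 := by
      simpa only [add_apply, FunLike.coe_smul, Pi.smul_apply,
        smul_eq_mul] using hv v
    exact key.ne' h'
  contMDiff := (g₀.contMDiff.const_smul_section (a := a)).add_section
    (g₁.contMDiff.const_smul_section (a := b))

variable (g₀ g₁ : PseudoRiemannianMetric IB n F V)

/-- `(a g₀ + b g₁)_x(v, w) = a g₀_x(v, w) + b g₁_x(v, w)`. [folklore] -/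
@[simp]
theorem _root_.Literature.Geometry.Lorentzian.PseudoRiemannianMetric.conicComb_apply
    (h₀ : g₀.IsRiemannian) (h₁ : g₁.IsRiemannian) (a b : ℝ) (ha : 0 ≤ a) (hb : 0 ≤ b) (hab : 0 < a + b) (x : B) (v w : V x) :
    (g₀.conicComb g₁ h₀ h₁ a b ha hb hab).val x v w = a * g₀.val x v w + b * g₁.val x v w := by
  simp only [conicComb, add_apply, FunLike.coe_smul, Pi.smul_apply,
    smul_eq_mul]

/-- A conic combination of Riemannian metrics is Riemannian. [folklore] -/
theorem _root_.Literature.Geometry.Lorentzian.PseudoRiemannianMetric.isRiemannian_conicComb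
    (h₀ : g₀.IsRiemannian) (h₁ : g₁.IsRiemannian) (a b : ℝ) (ha : 0 ≤ a) (hb : 0 ≤ b) (hab : 0 < a + b) :
    (g₀.conicComb g₁ h₀ h₁ a b ha hb hab).IsRiemannian := by
  intro x v hv
  rw [conicComb_apply]
  have hp0 := h₀ x v hv
  have hp1 := h₁ x v hv
  rcases ha.eq_or_lt with hzero | ha'
  · have hb' : 0 < b := by rw [← hzero, zero_add] at hab; exact hab
    rw [← hzero, zero_mul, zero_add]
    exact mul_pos hb' hp1
  · exact add_pos_of_pos_of_nonneg (mul_pos ha' hp0) (mul_nonneg hb hp1.le)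

/-- `1 · g₀ + 0 · g₁ = g₀`. [folklore] -/
theorem _root_.Literature.Geometry.Lorentzian.PseudoRiemannianMetric.conicComb_one_zero
    (h₀ : g₀.IsRiemannian) (h₁ : g₁.IsRiemannian) :
    g₀.conicComb g₁ h₀ h₁ 1 0 zero_le_one le_rfl (by norm_num) = g₀ := by
  ext x v w
  simp

/-- `0 · g₀ + 1 · g₁ = g₁`. [folklore] -/
theorem _root_.Literature.Geometry.Lorentzian.PseudoRiemannianMetric.conicComb_zero_one
    (h₀ : g₀.IsRiemannian) (h₁ : g₁.IsRiemannian) :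
    g₀.conicComb g₁ h₀ h₁ 0 1 le_rfl zero_le_one (by norm_num) = g₁ := by
  ext x v w
  simp

/-- **The path of metrics `γ_t = (1 - t) γ₀ + t γ₁`, `t ∈ [0, 1]`**, joining two Riemannian
metrics — the first sentence of the proof of Shi–Wang–Wei's Lemma 2.1: "Set
`γ_t = (1-t)γ₀ + tγ₁`. Then `{γ_t}_{t∈[0,1]}` is a smooth path of metrics on `Σ`." (`conicComb`
with `a = 1 - t`, `b = t`). Dot-notation extension of `PseudoRiemannianMetric`, absolute name.
[cite: ShiWangWei2022, proof of Lemma 2.1] -/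
def _root_.Literature.Geometry.Lorentzian.PseudoRiemannianMetric.linePath
    (h₀ : g₀.IsRiemannian) (h₁ : g₁.IsRiemannian) (t : ℝ)
    (ht : t ∈ Icc (0 : ℝ) 1) : PseudoRiemannianMetric IB n F V :=
  g₀.conicComb g₁ h₀ h₁ (1 - t) t (sub_nonneg.2 ht.2) ht.1 (by norm_num)

/-- `γ_t(v, w) = (1 - t) γ₀(v, w) + t γ₁(v, w)`. [cite: ShiWangWei2022, proof of Lemma 2.1] -/
@[simp]
theorem _root_.Literature.Geometry.Lorentzian.PseudoRiemannianMetric.linePath_apply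
    (h₀ : g₀.IsRiemannian) (h₁ : g₁.IsRiemannian) (t : ℝ)
    (ht : t ∈ Icc (0 : ℝ) 1) (x : B) (v w : V x) :
    (g₀.linePath g₁ h₀ h₁ t ht).val x v w = (1 - t) * g₀.val x v w + t * g₁.val x v w := by
  simp [linePath]

/-- Each `γ_t` is Riemannian ("a smooth path of metrics"). [cite: ShiWangWei2022, proof of Lemma 2.1] -/
theorem _root_.Literature.Geometry.Lorentzian.PseudoRiemannianMetric.isRiemannian_linePath
    (h₀ : g₀.IsRiemannian) (h₁ : g₁.IsRiemannian) (t : ℝ) (ht : t ∈ Icc (0 : ℝ) 1) : (g₀.linePath g₁ h₀ h₁ t ht).IsRiemannian :=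
  isRiemannian_conicComb g₀ g₁ h₀ h₁ _ _ _ _ _

/-- `γ_0 = γ₀`. [cite: ShiWangWei2022, proof of Lemma 2.1] -/
theorem _root_.Literature.Geometry.Lorentzian.PseudoRiemannianMetric.linePath_zero
    (h₀ : g₀.IsRiemannian) (h₁ : g₁.IsRiemannian) :
    g₀.linePath g₁ h₀ h₁ 0 ⟨le_rfl, zero_le_one⟩ = g₀ := by
  ext x v w
  simp

/-- `γ_1 = γ₁`. [cite: ShiWangWei2022, proof of Lemma 2.1] -/
theorem _root_.Literature.Geometry.Lorentzian.PseudoRiemannianMetric.linePath_one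
    (h₀ : g₀.IsRiemannian) (h₁ : g₁.IsRiemannian) :
    g₀.linePath g₁ h₀ h₁ 1 ⟨zero_le_one, le_rfl⟩ = g₁ := by
  ext x v w
  simp

/-- **`γ_t - γ_s = (t - s)(γ₁ - γ₀)`**: the path is affine in `t`, so its velocity is the
constant symmetric form `γ_t' = γ₁ - γ₀` (whence `Ā_t = ½ γ_t' = ½ (γ₁ - γ₀)` in the printed
proof of Lemma 2.1). [cite: ShiWangWei2022, proof of Lemma 2.1] -/
theorem _root_.Literature.Geometry.Lorentzian.PseudoRiemannianMetric.linePath_apply_sub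
    (h₀ : g₀.IsRiemannian) (h₁ : g₁.IsRiemannian) (s t : ℝ) (hs : s ∈ Icc (0 : ℝ) 1) (ht : t ∈ Icc (0 : ℝ) 1) (x : B) (v w : V x) :
    (g₀.linePath g₁ h₀ h₁ t ht).val x v w - (g₀.linePath g₁ h₀ h₁ s hs).val x v w =
      (t - s) * (g₁.val x v w - g₀.val x v w) := by
  simp only [linePath_apply]
  ring

/-- **Monotonicity of the path**: if `γ₀ ≤ γ₁` (as quadratic forms at `x`) then
`γ_s(v, v) ≤ γ_t(v, v)` for `s ≤ t`; with `linePath_zero`, `linePath_one` this gives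
`γ₀ ≤ γ_t ≤ γ₁`. With `γ₁ > γ₀` the slices expand, which is `H̄_t > 0` in the printed proof.
[cite: ShiWangWei2022, proof of Lemma 2.1] -/
theorem _root_.Literature.Geometry.Lorentzian.PseudoRiemannianMetric.linePath_apply_self_mono
    (h₀ : g₀.IsRiemannian) (h₁ : g₁.IsRiemannian) {x : B} (hle : ∀ v : V x, g₀.val x v v ≤ g₁.val x v v) {s t : ℝ} (hs : s ∈ Icc (0 : ℝ) 1)
    (ht : t ∈ Icc (0 : ℝ) 1) (hst : s ≤ t) (v : V x) :
    (g₀.linePath g₁ h₀ h₁ s hs).val x v v ≤ (g₀.linePath g₁ h₀ h₁ t ht).val x v v := by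
  have h := linePath_apply_sub g₀ g₁ h₀ h₁ s t hs ht x v v
  have hnonneg : 0 ≤ (t - s) * (g₁.val x v v - g₀.val x v v) :=
    mul_nonneg (sub_nonneg.2 hst) (sub_nonneg.2 (hle v))
  linarith

end ConicComb

end Literature.Geometry.Riemannian

end
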